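import Summits.AtomisticToContinuum.HydrodynamicLimit.Theses.AntiMazurCoboundaries
import Literature.Barriers.AtomisticToContinuum.HighMomentumCutoff

/-!
# KineticWindowGronwall (stmt-AtomisticToContinuum-9282) — crux-ideate round 1, ideator 3: Sketch

First-lemma signatures for the idea card `locality-inside-the-pressure`, plus the typed forms used by the
AMPLITUDE-BUDGET OBJECTION (IdeatorThreeBarrierNotes.md): the quadratic-growth re-typing of the shared
hypothesis 10967 under which Yau's kinetic-window Gronwall closes (Nachtergaele–Yau bookkeeping), and the
slowly-varying ("local") forms of the LD input that the Gronwall actually consumes at each window start.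
Everything is a `Prop` over existing declarations; nothing is asserted.
-/

noncomputable section

namespace Summit.AtomisticToContinuum.HydrodynamicLimit.Cruxes.KineticWindowGronwall.IdeatorThree

open scoped BigOperators ENNReal
open MeasureTheory Set
open Literature.MathematicalPhysics.KineticTheory Literature.Analysis.FluidPDE
open Summit.AtomisticToContinuum.HydrodynamicLimit.Theses.AntiMazurCoboundaries

/-- Sanity: the crux is literally the implication `KineticFluxLdDecay → RelEntropyVanishing`. -/
example : KineticWindowGronwall = (KineticFluxLdDecay → RelEntropyVanishing) := rfl

/-- **σ-UNIFORM form of the hypothesis** (barrier note BN3): `KineticFluxLdDecay` with the amplitude `κ`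
chosen BEFORE the reduced-density parameter `σ` (`∃ σ₀ ∃ κ ∀ σ < σ₀` instead of `∃ σ₀ ∀ σ < σ₀ ∃ κ`).
The kinetic-window Gronwall for local Gibbs references invokes the hypothesis at every reduced density
`σ ρ(t,x)^{1/3}` of the Euler solution (the constant activity `a` is a dummy of the canonical law), so
without local uniformity of `κ` in `σ` no N-independent Gronwall rate can be assembled. Any proof of
10967 by Galilean/scaling covariance yields this form. -/
def KineticFluxLdDecayUniform : Prop :=
  ∀ (a θ : ℝ) (u₀ : V3), 0 < a → 0 < θ → ∃ σ₀ : ℝ, 0 < σ₀ ∧ ∃ κ : ℝ, 0 < κ ∧ ∀ σ : ℝ, 0 < σ → σ < σ₀ →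
    (∀ (N : ℕ) (Φ : HardSphereFlow (Torus.geometry (Fin 3)) (hsDiameter σ N) (N + 1)),
      IsProbabilityMeasure (localGibbsLaw σ (fun _ => a) (fun _ => u₀) (fun _ => θ) N Φ)) ∧
    ∀ (φ : T3 → ℝ) (g : V3 → ℝ), Continuous φ → Continuous g → (∀ x, |φ x| ≤ 1) → (∀ v, |g v| ≤ κ) →
      (∀ (c₀ c₂ : ℝ) (b : V3), ∫ v, g v * (c₀ + inner ℝ b v + c₂ * ‖v‖ ^ 2) ∂(ProbabilityTheory.stdGaussian V3) = 0) →
      ∀ δ : ℝ, 0 < δ → ∃ τ : ℝ, 0 < τ ∧ ∃ N₀ : ℕ, ∀ N : ℕ, N₀ ≤ N →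
        ∀ Φ : HardSphereFlow (Torus.geometry (Fin 3)) (hsDiameter σ N) (N + 1),
          ∫⁻ z, ENNReal.ofReal (Real.exp ((τ * ((N + 1 : ℕ) : ℝ) ^ (-(1 / 3 : ℝ)))⁻¹ *
              ∫ s in (0 : ℝ)..(τ * ((N + 1 : ℕ) : ℝ) ^ (-(1 / 3 : ℝ))),
                ∑ i, φ (Φ.flow s z i).1 * g ((Real.sqrt θ)⁻¹ • ((Φ.flow s z i).2 - u₀))))
            ∂(localGibbsLaw σ (fun _ => a) (fun _ => u₀) (fun _ => θ) N Φ) ≤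
          ENNReal.ofReal (Real.exp (δ * (N + 1)))

/-- **The LOCAL (slowly-varying) LD input that the window Gronwall consumes**: for a continuous
time-dependent profile `(a_t, u_t, θ_t)` on `[0,T] × 𝕋³` (think: the activity/velocity/temperature of
the local Gibbs reference driven by the Euler solution) and a continuous time-dependent test function
`φ_t` (think: a component of `∇λ(t,·)`), the kinetic-window exponential moment of the fast one-body
functional `Σ_i φ_t(x_i(s)) g((v_i(s) − u_t(x_i(s)))/√θ_t(x_i(s)))` — standardised in the LOCAL frame,
`g ⊥ span(1,v,|v|²)` in `L²(stdGaussian)` — under the local Gibbs law `localGibbsLaw σ a_t u_t θ_t`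
is `exp(o(N))`, with ONE window `τ` and ONE `N₀` serving every `t ∈ [0,T]` (compactness of the profile
family). This is the statement "log ∫ e^{βX} dψ_t ≤ N(Λ_τ + o(1)) after LOCALISING" of the crux's
docstring, made a Prop. Bounded class `|g| ≤ κ` (what 10967 as typed can feed). -/
def LocalKineticFluxLd : Prop :=
  ∀ (T : ℝ) (a θ : ℝ → T3 → ℝ) (u : ℝ → T3 → V3),
    Continuous (Function.uncurry a) → Continuous (Function.uncurry θ) → Continuous (Function.uncurry u) →
    (∀ t x, 0 < a t x) → (∀ t x, 0 < θ t x) →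
    ∃ σ₀ : ℝ, 0 < σ₀ ∧ ∀ σ : ℝ, 0 < σ → σ < σ₀ →
      (∀ t ∈ Icc (0 : ℝ) T, ∀ (N : ℕ) (Φ : HardSphereFlow (Torus.geometry (Fin 3)) (hsDiameter σ N) (N + 1)),
        IsProbabilityMeasure (localGibbsLaw σ (a t) (u t) (θ t) N Φ)) ∧
      ∃ κ : ℝ, 0 < κ ∧ ∀ (φ : ℝ → T3 → ℝ) (g : V3 → ℝ), Continuous (Function.uncurry φ) → Continuous g →
        (∀ t x, |φ t x| ≤ 1) → (∀ v, |g v| ≤ κ) →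
        (∀ (c₀ c₂ : ℝ) (b : V3), ∫ v, g v * (c₀ + inner ℝ b v + c₂ * ‖v‖ ^ 2) ∂(ProbabilityTheory.stdGaussian V3) = 0) →
        ∀ δ : ℝ, 0 < δ → ∃ τ : ℝ, 0 < τ ∧ ∃ N₀ : ℕ, ∀ N : ℕ, N₀ ≤ N → ∀ t ∈ Icc (0 : ℝ) T,
          ∀ Φ : HardSphereFlow (Torus.geometry (Fin 3)) (hsDiameter σ N) (N + 1),
            ∫⁻ z, ENNReal.ofReal (Real.exp ((τ * ((N + 1 : ℕ) : ℝ) ^ (-(1 / 3 : ℝ)))⁻¹ *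
                ∫ s in (0 : ℝ)..(τ * ((N + 1 : ℕ) : ℝ) ^ (-(1 / 3 : ℝ))),
                  ∑ i, φ t (Φ.flow s z i).1 *
                    g ((Real.sqrt (θ t (Φ.flow s z i).1))⁻¹ • ((Φ.flow s z i).2 - u t (Φ.flow s z i).1))))
              ∂(localGibbsLaw σ (a t) (u t) (θ t) N Φ) ≤
            ENNReal.ofReal (Real.exp (δ * (N + 1)))

/-- **FIRST LEMMA of the line `locality-inside-the-pressure` (the localisation theorem).** Dynamical
influence-locality in LD currency (the AntiMazur route's typed crux `InfluenceLocality`, 13916) is the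
localisation currency: freeze the reference blockwise (static Rényi cost `O(N R²)`), decouple blocks by
the hard-core Markov property + chessboard Hölder + ensemble equivalence, replace each block functional
by the isolated-cluster functional (locality, superexponentially rare bad sets transfer through
`dψ/dG_hot ≤ e^{KN}`), and bound each block pressure by the σ-uniform hypothesis on a comparison torus at
the block's own reduced density (exact Galilean/scaling covariance for `(u,θ)`, `δ := ε R³/27`). -/
def LocalisationLemma : Prop :=
  KineticFluxLdDecayUniform → InfluenceLocality → LocalKineticFluxLd

/-- **Proposed re-typing of the shared hypothesis 10967 (QUADRATIC-GROWTH class; AMPLITUDE-BUDGET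
OBJECTION BN1).** Same frame as `KineticFluxLdDecay`, but the fast observable may grow quadratically,
`|g(w)| ≤ κ(1 + ‖w‖²)` (the class of the retired route KineticWindows' `KineticWindowLD`), with `κ`
uniform in `σ`. The truncated heat flux `w(‖w‖²−5)/2 · χ(‖w‖ ≤ A)` divided by `A` lies in this class with
an A-INDEPENDENT constant, so the entropy-inequality amplitude is `≍ 1/A` and the Gronwall rate `≍ A`
(Nachtergaele–Yau's `δ⁻¹M`), which a Gaussian tail bound `e^{-cA²}` beats; with the bounded class the rate
is `≍ A³` and nothing beats it. Exponential moments are finite for each `N` since `Σ‖w_i‖²` is dominated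
by the conserved kinetic energy. -/
def KineticFluxLdDecayQuad : Prop :=
  ∀ (a θ : ℝ) (u₀ : V3), 0 < a → 0 < θ → ∃ σ₀ : ℝ, 0 < σ₀ ∧ ∃ κ : ℝ, 0 < κ ∧ ∀ σ : ℝ, 0 < σ → σ < σ₀ →
    (∀ (N : ℕ) (Φ : HardSphereFlow (Torus.geometry (Fin 3)) (hsDiameter σ N) (N + 1)),
      IsProbabilityMeasure (localGibbsLaw σ (fun _ => a) (fun _ => u₀) (fun _ => θ) N Φ)) ∧
    ∀ (φ : T3 → ℝ) (g : V3 → ℝ), Continuous φ → Continuous g → (∀ x, |φ x| ≤ 1) →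
      (∀ v, |g v| ≤ κ * (1 + ‖v‖ ^ 2)) →
      (∀ (c₀ c₂ : ℝ) (b : V3), ∫ v, g v * (c₀ + inner ℝ b v + c₂ * ‖v‖ ^ 2) ∂(ProbabilityTheory.stdGaussian V3) = 0) →
      ∀ δ : ℝ, 0 < δ → ∃ τ : ℝ, 0 < τ ∧ ∃ N₀ : ℕ, ∀ N : ℕ, N₀ ≤ N →
        ∀ Φ : HardSphereFlow (Torus.geometry (Fin 3)) (hsDiameter σ N) (N + 1),
          ∫⁻ z, ENNReal.ofReal (Real.exp ((τ * ((N + 1 : ℕ) : ℝ) ^ (-(1 / 3 : ℝ)))⁻¹ *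
              ∫ s in (0 : ℝ)..(τ * ((N + 1 : ℕ) : ℝ) ^ (-(1 / 3 : ℝ))),
                ∑ i, φ (Φ.flow s z i).1 * g ((Real.sqrt θ)⁻¹ • ((Φ.flow s z i).2 - u₀))))
            ∂(localGibbsLaw σ (fun _ => a) (fun _ => u₀) (fun _ => θ) N Φ) ≤
          ENNReal.ofReal (Real.exp (δ * (N + 1)))

/-- The quadratic-growth class contains the bounded class: the re-typed 10967 implies the σ-uniform form of
the typed one (take the same `κ`; `κ ≤ κ(1+‖v‖²)`). Recorded as a Prop (one-line proof expected). -/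
def quad_implies_uniform : Prop :=
  KineticFluxLdDecayQuad → KineticFluxLdDecayUniform

/-- **Gaussian shell moment with explicit decay in the cut-off level** (the brick that makes NY's dyadic
shell errors summable; quantitative form of conjunct (3) of `HighMomentumCutoffBarrierNarrow`): for
`0 < c < 1/(2θ)` the quadratic exponential moment of the Maxwellian restricted to `{‖p‖ > A}` decays like
`exp(−(1/(2θ) − c) A²/2)`. [folklore] -/
def GaussianShellMoment : Prop :=
  ∀ θ c : ℝ, 0 < θ → 0 < c → c < 1 / (2 * θ) → ∃ K : ℝ, 0 < K ∧ ∀ A : ℝ, 0 ≤ A →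
    ∫⁻ p in {p : V3 | A < ‖p‖}, ENNReal.ofReal (Real.exp (c * ‖p‖ ^ 2 - ‖p‖ ^ 2 / (2 * θ))) ≤
      ENNReal.ofReal (K * Real.exp (-((1 / (2 * θ) - c) / 2) * A ^ 2))

/-- **The tail child this architecture needs, exactly** (barrier note BN2): Nachtergaele–Yau's Gaussian
moment bound along the TRUE evolution, `Literature.Barriers.AtomisticToContinuum.HighMomentumCutoff`, on the
whole range of reduced densities met by the Euler solution — used through Chebyshev, never through the
entropy inequality. Stated here as "for all small σ" (the re-typed 9282 would carry it as a hypothesis). -/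
def GaussianTailsAlongEvolution : Prop :=
  ∃ σ₀ : ℝ, 0 < σ₀ ∧ ∀ σ : ℝ, 0 < σ → σ < σ₀ → Literature.Barriers.AtomisticToContinuum.HighMomentumCutoff σ

end Summit.AtomisticToContinuum.HydrodynamicLimit.Cruxes.KineticWindowGronwall.IdeatorThree

end
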